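import Literature.Probability.Process.StableLikeJumpChainKernel
import Literature.Probability.Process.StableLikeJumpChainNash
import HarnessLib

/-!
# On-diagonal upper bound `p(n,x,y) ≤ C n^{-d/α}` (Bass–Levin Thm 4.3) — discrete Nash argument

Support file for the proof of Bass–Levin 2002, Theorem 1.1
(`Literature.Probability.Process.bassLevin_thm_1_1`). For a Markov kernel `P` on `ℤ^d`,
reversible with respect to weights `m ≤ μ ≤ M` and with the stable-like lower bound
`P x y ≥ c₁ ‖x−y‖^{-(d+α)}`, we prove the uniform bound `Q n x y ≤ C n^{-d/α}` (`n ≥ 1`) for its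
powers `Q` (`kpow_diag_bound`).

Route (a discrete-time Carlen–Kusuoka–Stroock iteration; replaces the eigenfunction-expansion /
Poisson-clock transfer of Bass–Levin's proof of Thm 4.3):
* `kpow_two_lower` : the two-step kernel dominates `c ‖x−z‖^{-(d+α)}` off the diagonal;
* `energy_identity` : for the column `G = Q n · y`, with `u n = ∑_x μ_x G(x)²`,
  `2 (u n - u (n+1)) = ∑_x ∑_z μ_x Q² x z (G x - G z)²` (the Dirichlet form of `P²`);
* Nash (`nash_parametrized`) turns this into `u n - u (n+1) ≥ a r^{-α} (b u n - e r^{-d})`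
  for every integer `r ≥ 1`, and the real-variable lemmas `step_of_parametrized`,
  `seq_decay` give `u n ≤ C n^{-d/α}`;
* Cauchy–Schwarz/AM–GM in Chapman–Kolmogorov gives the pointwise bound.

[folklore] (Nash 1958; Carlen–Kusuoka–Stroock 1987, §2; Bass–Levin 2002 Thm 4.3.)

## References
* R. F. Bass, D. A. Levin, *Transition probabilities for symmetric jump processes*,
  Trans. Amer. Math. Soc. 354 (2002) 2933–2953, Theorem 4.3.
* E. A. Carlen, S. Kusuoka, D. W. Stroock, *Upper bounds for symmetric Markov transition
  functions*, Ann. IHP 23 (1987) 245–287, Thm 2.1.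
-/

noncomputable section

namespace Literature.Probability.Process

open scoped BigOperators

section RealSeq

/-- **One step of the Nash iteration.** If `0 ≤ v' ≤ v ≤ U` and for every integer `r ≥ 1`
`a r^{-α} (b v - e r^{-δ}) ≤ v - v'` (`a, b, e, α, δ > 0`), then
`κ₀ v^{1+α/δ} ≤ v - v'` with an explicit `κ₀ > 0` depending only on `a, b, e, α, δ, U`.
[folklore] -/
theorem step_of_parametrized {v v' a b e α δ U : ℝ} (ha : 0 < a) (hb : 0 < b) (he : 0 < e)
    (hα : 0 < α) (hδ : 0 < δ) (hv : 0 ≤ v) (hvU : v ≤ U) (hv' : v' ≤ v)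
    (H : ∀ r : ℕ, 1 ≤ r → a * (r : ℝ) ^ (-α) * (b * v - e * (r : ℝ) ^ (-δ)) ≤ v - v') :
    a * (2 : ℝ) ^ (-α) * (b / 2) * (b / (2 * e * max 1 (b * U / (2 * e)))) ^ (α / δ) *
        v ^ (1 + α / δ) ≤ v - v' := by
  set T : ℝ := max 1 (b * U / (2 * e)) with hT
  have hT1 : 1 ≤ T := le_max_left _ _
  have hTpos : 0 < T := lt_of_lt_of_le one_pos hT1
  rcases hv.eq_or_lt with hv0 | hvpos
  · -- v = 0
    rw [← hv0, Real.zero_rpow (by positivity), mul_zero]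
    linarith
  set t : ℝ := b * v / (2 * e) with ht
  have htpos : 0 < t := by rw [ht]; positivity
  have htT : t ≤ T := by
    rw [ht, hT]
    refine le_trans ?_ (le_max_right _ _)
    exact div_le_div_of_nonneg_right (by nlinarith) (by positivity)
  set R : ℝ := t ^ (-1 / δ) with hR
  have hRpos : 0 < R := Real.rpow_pos_of_pos htpos _
  set r : ℕ := ⌈R⌉₊ with hr
  have hr1 : 1 ≤ r := Nat.succ_le_of_lt (Nat.ceil_pos.mpr hRpos)
  have hrR : R ≤ (r : ℝ) := Nat.le_ceil R
  have hrR1 : (r : ℝ) < R + 1 := Nat.ceil_lt_add_one hRpos.le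
  have hr0 : (0 : ℝ) < r := by exact_mod_cast hr1
  -- e r^{-δ} ≤ b v / 2
  have hRδ : R ^ (-δ) = t := by
    rw [hR, ← Real.rpow_mul htpos.le]
    have : -1 / δ * -δ = 1 := by field_simp
    rw [this, Real.rpow_one]
  have h1 : e * (r : ℝ) ^ (-δ) ≤ b * v / 2 := by
    have : (r : ℝ) ^ (-δ) ≤ R ^ (-δ) := Real.rpow_le_rpow_of_nonpos hRpos hrR (by linarith)
    rw [hRδ, ht] at this
    calc e * (r : ℝ) ^ (-δ) ≤ e * (b * v / (2 * e)) := mul_le_mul_of_nonneg_left this he.le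
      _ = b * v / 2 := by field_simp
  have h2 : a * (r : ℝ) ^ (-α) * (b * v / 2) ≤ v - v' := by
    refine le_trans ?_ (H r hr1)
    exact mul_le_mul_of_nonneg_left (by linarith) (by positivity)
  -- r^{-α} ≥ 2^{-α} (t/T)^{α/δ}
  have h3 : (2 : ℝ) ^ (-α) * (t / T) ^ (α / δ) ≤ (r : ℝ) ^ (-α) := by
    have hrle : (r : ℝ) ≤ 2 * max R 1 := by
      have := le_max_left R 1
      have := le_max_right R 1
      linarith
    have hmaxpos : 0 < max R 1 := lt_of_lt_of_le one_pos (le_max_right _ _)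
    have hstep1 : (2 * max R 1) ^ (-α) ≤ (r : ℝ) ^ (-α) :=
      Real.rpow_le_rpow_of_nonpos hr0 hrle (by linarith)
    refine le_trans ?_ hstep1
    rw [Real.mul_rpow (by norm_num) hmaxpos.le]
    refine mul_le_mul_of_nonneg_left ?_ (Real.rpow_nonneg (by norm_num) _)
    -- (t/T)^{α/δ} ≤ (max R 1)^{-α}
    rcases le_or_gt 1 R with hR1 | hR1
    · rw [max_eq_left hR1, hR, ← Real.rpow_mul htpos.le]
      have : -1 / δ * -α = α / δ := by field_simp
      rw [this]
      exact Real.rpow_le_rpow (by positivity) (div_le_self htpos.le hT1) (by positivity)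
    · rw [max_eq_right hR1.le, Real.one_rpow]
      exact Real.rpow_le_one (by positivity) ((div_le_one hTpos).mpr htT) (by positivity)
  -- combine
  have h4 : a * ((2 : ℝ) ^ (-α) * (t / T) ^ (α / δ)) * (b * v / 2) ≤ v - v' := by
    refine le_trans ?_ h2
    exact mul_le_mul_of_nonneg_right (mul_le_mul_of_nonneg_left h3 ha.le) (by positivity)
  have h5 : (t / T) ^ (α / δ) * v = (b / (2 * e * T)) ^ (α / δ) * v ^ (1 + α / δ) := by
    have htT' : t / T = b / (2 * e * T) * v := by rw [ht]; field_simp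
    rw [htT', Real.mul_rpow (by positivity) hv, Real.rpow_add hvpos, Real.rpow_one]
    ring
  calc a * (2 : ℝ) ^ (-α) * (b / 2) * (b / (2 * e * T)) ^ (α / δ) * v ^ (1 + α / δ)
      = a * ((2 : ℝ) ^ (-α) * ((t / T) ^ (α / δ) * v)) * (b / 2) := by rw [h5]; ring
    _ = a * ((2 : ℝ) ^ (-α) * (t / T) ^ (α / δ)) * (b * v / 2) := by ring
    _ ≤ v - v' := h4

/-- **Decay of the Nash recursion.** If `u ≥ 0` is nonincreasing and
`κ₀ u(n)^{1+p} ≤ u(n) - u(n+1)` (`κ₀, p > 0`), then `u(n) ≤ (p κ₀ n)^{-1/p}` for `n ≥ 1`.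
[folklore] -/
theorem seq_decay {u : ℕ → ℝ} {κ₀ p : ℝ} (hp : 0 < p) (hκ : 0 < κ₀) (hu0 : ∀ n, 0 ≤ u n)
    (hmono : ∀ n, u (n + 1) ≤ u n) (hstep : ∀ n, κ₀ * u n ^ (1 + p) ≤ u n - u (n + 1))
    {n : ℕ} (hn : 1 ≤ n) : u n ≤ (p * κ₀ * n) ^ (-(1 / p)) := by
  -- w n := (u n)^{-p} grows at least linearly
  have key : ∀ n, 0 < u n → p * κ₀ * n ≤ u n ^ (-p) := by
    intro n
    induction n with
    | zero => intro h0; simp [Real.rpow_nonneg h0.le]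
    | succ n ih =>
      intro hpos
      have hposn : 0 < u n := lt_of_lt_of_le hpos (hmono n)
      have ihn := ih hposn
      set τ : ℝ := κ₀ * u n ^ p with hτ
      have hτnn : 0 ≤ τ := by positivity
      have hle : u (n + 1) ≤ u n * (1 - τ) := by
        have := hstep n
        have hsplit : u n ^ (1 + p) = u n * u n ^ p := by
          rw [Real.rpow_add hposn, Real.rpow_one]
        rw [hsplit] at this
        rw [hτ]; linarith
      have hτ1 : τ < 1 := by
        by_contra hge
        push Not at hge
        have : u n * (1 - τ) ≤ 0 := mul_nonpos_of_nonneg_of_nonpos hposn.le (by linarith)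
        linarith
      have hw : u n ^ (-p) * (1 + p * τ) ≤ u (n + 1) ^ (-p) := by
        calc u n ^ (-p) * (1 + p * τ) ≤ u n ^ (-p) * (1 - τ) ^ (-p) :=
              mul_le_mul_of_nonneg_left (one_add_mul_le_one_sub_rpow_neg hp.le hτ1)
                (Real.rpow_nonneg hposn.le _)
          _ = (u n * (1 - τ)) ^ (-p) := (Real.mul_rpow hposn.le (by linarith)).symm
          _ ≤ u (n + 1) ^ (-p) := Real.rpow_le_rpow_of_nonpos hpos hle (by linarith)
      have hprod : u n ^ (-p) * τ = κ₀ := by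
        rw [hτ, ← mul_assoc, mul_comm (u n ^ (-p)), mul_assoc, ← Real.rpow_add hposn,
          neg_add_cancel, Real.rpow_zero, mul_one]
      calc p * κ₀ * ((n + 1 : ℕ) : ℝ) = p * κ₀ * n + p * κ₀ := by push_cast; ring
        _ ≤ u n ^ (-p) + p * (u n ^ (-p) * τ) := by rw [hprod]; linarith
        _ = u n ^ (-p) * (1 + p * τ) := by ring
        _ ≤ u (n + 1) ^ (-p) := hw
  rcases (hu0 n).eq_or_lt with h0 | hpos
  · rw [← h0]; exact Real.rpow_nonneg (by positivity) _
  · have hw := key n hpos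
    have hwpos : 0 < p * κ₀ * n := by
      have : (1 : ℝ) ≤ n := by exact_mod_cast hn
      positivity
    have : u n = (u n ^ (-p)) ^ (-(1 / p)) := by
      rw [← Real.rpow_mul hpos.le]
      have : -p * -(1 / p) = 1 := by field_simp
      rw [this, Real.rpow_one]
    rw [this]
    exact Real.rpow_le_rpow_of_nonpos hwpos hw (by
      have : 0 < 1 / p := by positivity
      linarith)

end RealSeq

section Kernel

variable {d : ℕ} {P : (Fin d → ℤ) → (Fin d → ℤ) → ℝ} {Q : ℕ → (Fin d → ℤ) → (Fin d → ℤ) → ℝ}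
  {μ : (Fin d → ℤ) → ℝ} {m M c₁ α : ℝ}

/-- **Two-step lower bound.** If `P x y ≥ c₁ ‖x−y‖^{-(d+α)}` for all `x, y` (a stable-like
Markov kernel on `ℤ^d`, `d ≥ 1`), then off the diagonal the two-step kernel satisfies
`Q 2 x z ≥ c₁² 2^{-(d+α)} ‖x−z‖^{-(d+α)}`. Bass–Levin use such bounds tacitly
("by (1.2) and (2.1) … `p(2,x,x) ≥ c₈`", proof of Prop. 5.1). [cite: BassLevin2002, §5 proof of Prop. 5.1] -/
theorem kpow_two_lower (hd : 1 ≤ d) (hα : 0 < α) (hP0 : ∀ x y, 0 ≤ P x y)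
    (hP1 : ∀ x, HasSum (P x) 1)
    (hlb : ∀ x y, c₁ * ‖x - y‖ ^ (-((d : ℝ) + α)) ≤ P x y) (hc₁ : 0 ≤ c₁)
    (hQ0 : ∀ x y, Q 0 x y = if x = y then 1 else 0)
    (hQ : ∀ n x y, Q (n + 1) x y = ∑' z, Q n x z * P z y) {x z : Fin d → ℤ} (hxz : x ≠ z) :
    c₁ ^ 2 * (2 : ℝ) ^ (-((d : ℝ) + α)) * ‖x - z‖ ^ (-((d : ℝ) + α)) ≤ Q 2 x z := by
  have hPs : ∀ x, Summable (P x) := fun x => (hP1 x).summable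
  have hP1' : ∀ x, ∑' y, P x y ≤ 1 := fun x => ((hP1 x).tsum_eq).le
  set s : ℝ := (d : ℝ) + α with hs
  have hspos : 0 < s := by rw [hs]; positivity
  obtain ⟨i0⟩ : Nonempty (Fin d) := ⟨⟨0, hd⟩⟩
  set e : Fin d → ℤ := Pi.single i0 1 with he
  have hne : ‖e‖ = 1 := by rw [he, Pi.norm_single]; simp
  -- choose the intermediate point w ∉ {z}, at distance 1 from x
  obtain ⟨w, hwx, hwz⟩ : ∃ w, ‖w - x‖ = 1 ∧ w ≠ z := by
    by_cases h : x + e = z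
    · refine ⟨x - e, by simp [hne], fun h' => ?_⟩
      have h1 := congrFun h i0
      have h2 := congrFun h' i0
      simp [he] at h1 h2
      omega
    · exact ⟨x + e, by simp [hne], h⟩
  have hxzpos : 0 < ‖x - z‖ := norm_pos_iff.mpr (sub_ne_zero.mpr hxz)
  have hxz1 : 1 ≤ ‖x - z‖ := one_le_norm_of_ne_zero (sub_ne_zero.mpr hxz)
  have hwzle : ‖w - z‖ ≤ 2 * ‖x - z‖ := by
    calc ‖w - z‖ = ‖(w - x) + (x - z)‖ := by congr 1; abel
      _ ≤ ‖w - x‖ + ‖x - z‖ := norm_add_le _ _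
      _ = 1 + ‖x - z‖ := by rw [hwx]
      _ ≤ 2 * ‖x - z‖ := by linarith
  have hwzpos : 0 < ‖w - z‖ := norm_pos_iff.mpr (sub_ne_zero.mpr hwz)
  -- P x w ≥ c₁ and P w z ≥ c₁ (2‖x−z‖)^{-s}
  have h1 : c₁ ≤ P x w := by
    have := hlb x w
    rwa [norm_sub_rev, hwx, Real.one_rpow, mul_one] at this
  have h2 : c₁ * (2 : ℝ) ^ (-s) * ‖x - z‖ ^ (-s) ≤ P w z := by
    refine le_trans ?_ (hlb w z)
    rw [mul_assoc, ← Real.mul_rpow (by norm_num) hxzpos.le]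
    exact mul_le_mul_of_nonneg_left (Real.rpow_le_rpow_of_nonpos hwzpos hwzle (by linarith)) hc₁
  calc c₁ ^ 2 * (2 : ℝ) ^ (-s) * ‖x - z‖ ^ (-s) = c₁ * (c₁ * (2 : ℝ) ^ (-s) * ‖x - z‖ ^ (-s)) := by
        ring
    _ ≤ P x w * P w z := mul_le_mul h1 h2 (by positivity) (hP0 x w)
    _ = Q 1 x w * Q 1 w z := by rw [kpow_one hQ0 hQ, kpow_one hQ0 hQ]
    _ ≤ Q (1 + 1) x z := kpow_mul_kpow_le_kpow_add hP0 hPs hP1' hQ0 hQ 1 1 x w z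

/-- The two-step kernel is bounded below on the diagonal: `Q 2 x x ≥ c₁²`. [cite: BassLevin2002, §5 proof of Prop. 5.1] -/
theorem kpow_two_diag_lower (hd : 1 ≤ d) (hP0 : ∀ x y, 0 ≤ P x y)
    (hP1 : ∀ x, HasSum (P x) 1)
    (hlb : ∀ x y, c₁ * ‖x - y‖ ^ (-((d : ℝ) + α)) ≤ P x y) (hc₁ : 0 ≤ c₁)
    (hQ0 : ∀ x y, Q 0 x y = if x = y then 1 else 0)
    (hQ : ∀ n x y, Q (n + 1) x y = ∑' z, Q n x z * P z y) (x : Fin d → ℤ) :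
    c₁ ^ 2 ≤ Q 2 x x := by
  have hPs : ∀ x, Summable (P x) := fun x => (hP1 x).summable
  have hP1' : ∀ x, ∑' y, P x y ≤ 1 := fun x => ((hP1 x).tsum_eq).le
  obtain ⟨i0⟩ : Nonempty (Fin d) := ⟨⟨0, hd⟩⟩
  set e : Fin d → ℤ := Pi.single i0 1 with he
  have hne : ‖e‖ = 1 := by rw [he, Pi.norm_single]; simp
  have h1 : c₁ ≤ P x (x + e) := by
    have := hlb x (x + e)
    rwa [sub_add_cancel_left, norm_neg, hne, Real.one_rpow, mul_one] at this
  have h2 : c₁ ≤ P (x + e) x := by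
    have := hlb (x + e) x
    rwa [add_sub_cancel_left, hne, Real.one_rpow, mul_one] at this
  calc c₁ ^ 2 = c₁ * c₁ := sq c₁
    _ ≤ P x (x + e) * P (x + e) x := mul_le_mul h1 h2 hc₁ (hP0 _ _)
    _ = Q 1 x (x + e) * Q 1 (x + e) x := by rw [kpow_one hQ0 hQ, kpow_one hQ0 hQ]
    _ ≤ Q (1 + 1) x x := kpow_mul_kpow_le_kpow_add hP0 hPs hP1' hQ0 hQ 1 1 x (x + e) x


/-! ### The column `G n = Q n · y`: summability bookkeeping -/

/-- Columns of the powers of a reversible kernel with weights in `[m, M]` are bounded by `M/m`.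
[folklore] -/
theorem kpow_le_ratio (hP0 : ∀ x y, 0 ≤ P x y) (hP1 : ∀ x, HasSum (P x) 1)
    (hμ : ∀ x, m ≤ μ x ∧ μ x ≤ M) (hm : 0 < m)
    (hrev : ∀ x y, μ x * P x y = μ y * P y x)
    (hQ0 : ∀ x y, Q 0 x y = if x = y then 1 else 0)
    (hQ : ∀ n x y, Q (n + 1) x y = ∑' z, Q n x z * P z y) (n : ℕ) (x y : Fin d → ℤ) :
    Q n x y ≤ M / m := by
  have hPs : ∀ x, Summable (P x) := fun x => (hP1 x).summable
  have hP1' : ∀ x, ∑' y, P x y ≤ 1 := fun x => ((hP1 x).tsum_eq).le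
  have hμpos : ∀ x, 0 < μ x := fun x => lt_of_lt_of_le hm (hμ x).1
  calc Q n x y ≤ μ y / μ x := kpow_le_div hP0 hPs hP1' hQ0 hQ hμpos hrev n x y
    _ ≤ M / m := div_le_div₀ (le_trans hm.le ((hμ y).1.trans (hμ y).2) |>.trans le_rfl)
        (hμ y).2 hm (hμ x).1

/-- The weighted column `x ↦ μ x * Q n x y` is summable with sum at most `M`. [folklore] -/
theorem summable_mu_mul_kpow (hP0 : ∀ x y, 0 ≤ P x y) (hP1 : ∀ x, HasSum (P x) 1)
    (hμ : ∀ x, m ≤ μ x ∧ μ x ≤ M) (hm : 0 < m)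
    (hrev : ∀ x y, μ x * P x y = μ y * P y x)
    (hQ0 : ∀ x y, Q 0 x y = if x = y then 1 else 0)
    (hQ : ∀ n x y, Q (n + 1) x y = ∑' z, Q n x z * P z y) (n : ℕ) (y : Fin d → ℤ) :
    Summable (fun x => μ x * Q n x y) ∧ ∑' x, μ x * Q n x y ≤ M := by
  have hPs : ∀ x, Summable (P x) := fun x => (hP1 x).summable
  have hP1' : ∀ x, ∑' y, P x y ≤ 1 := fun x => ((hP1 x).tsum_eq).le
  have hμnn : ∀ x, 0 ≤ μ x := fun x => hm.le.trans (hμ x).1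
  obtain ⟨hs, hle⟩ := kpow_column hP0 hPs hP1' hQ0 hQ hμnn hrev n y
  exact ⟨hs, hle.trans (hμ y).2⟩

/-- The column `x ↦ Q n x y` is summable with sum at most `M/m`. [folklore] -/
theorem summable_kpow_col (hP0 : ∀ x y, 0 ≤ P x y) (hP1 : ∀ x, HasSum (P x) 1)
    (hμ : ∀ x, m ≤ μ x ∧ μ x ≤ M) (hm : 0 < m)
    (hrev : ∀ x y, μ x * P x y = μ y * P y x)
    (hQ0 : ∀ x y, Q 0 x y = if x = y then 1 else 0)
    (hQ : ∀ n x y, Q (n + 1) x y = ∑' z, Q n x z * P z y) (n : ℕ) (y : Fin d → ℤ) :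
    Summable (fun x => Q n x y) ∧ ∑' x, Q n x y ≤ M / m := by
  obtain ⟨hs, hle⟩ := summable_mu_mul_kpow hP0 hP1 hμ hm hrev hQ0 hQ n y
  have hQnn : ∀ k x w, 0 ≤ Q k x w := kpow_nonneg hP0 hQ0 hQ
  have hpt : ∀ x, Q n x y ≤ m⁻¹ * (μ x * Q n x y) := by
    intro x
    rw [← mul_assoc]
    refine le_mul_of_one_le_left (hQnn n x y) ?_
    rw [inv_mul_eq_div, one_le_div hm]
    exact (hμ x).1
  have hs' : Summable fun x => Q n x y := (hs.mul_left m⁻¹).of_nonneg_of_le (hQnn n · y) hpt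
  refine ⟨hs', ?_⟩
  calc ∑' x, Q n x y ≤ ∑' x, m⁻¹ * (μ x * Q n x y) := Summable.tsum_le_tsum hpt hs' (hs.mul_left _)
    _ = m⁻¹ * ∑' x, μ x * Q n x y := tsum_mul_left
    _ ≤ m⁻¹ * M := mul_le_mul_of_nonneg_left hle (inv_nonneg.mpr hm.le)
    _ = M / m := inv_mul_eq_div m M

/-- **The cross term**: `∑_x μ_x G(x) G₂(x) = ∑_x μ_x G₁(x)²` where `G_k = Q (n+k) · y`
(reversibility). [folklore] -/
theorem tsum_mu_mul_kpow_mul_kpow_two (hP0 : ∀ x y, 0 ≤ P x y) (hP1 : ∀ x, HasSum (P x) 1)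
    (hμ : ∀ x, m ≤ μ x ∧ μ x ≤ M) (hm : 0 < m)
    (hrev : ∀ x y, μ x * P x y = μ y * P y x)
    (hQ0 : ∀ x y, Q 0 x y = if x = y then 1 else 0)
    (hQ : ∀ n x y, Q (n + 1) x y = ∑' z, Q n x z * P z y) (n : ℕ) (y : Fin d → ℤ) :
    (Summable fun x => μ x * Q n x y * Q (n + 2) x y) ∧
      ∑' x, μ x * Q n x y * Q (n + 2) x y = ∑' x, μ x * Q (n + 1) x y ^ 2 := by
  have hPs : ∀ x, Summable (P x) := fun x => (hP1 x).summable
  have hP1' : ∀ x, ∑' y, P x y ≤ 1 := fun x => ((hP1 x).tsum_eq).le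
  have hμnn : ∀ x, 0 ≤ μ x := fun x => hm.le.trans (hμ x).1
  have hQnn : ∀ k x w, 0 ≤ Q k x w := kpow_nonneg hP0 hQ0 hQ
  have hB : ∀ k x, Q k x y ≤ M / m := fun k x => kpow_le_ratio hP0 hP1 hμ hm hrev hQ0 hQ k x y
  have hMm : 0 ≤ M / m := le_trans (hQnn 0 y y) (hB 0 y)
  -- G₂ x = ∑' z, P x z * G₁ z  and  G₁ z = ∑' x, P z x * G x
  have hG2 : ∀ x, Q (n + 2) x y = ∑' z, P x z * Q (n + 1) z y :=
    fun x => kpow_succ_left hP0 hPs hP1' hQ0 hQ (n + 1) x y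
  have hG1 : ∀ z, Q (n + 1) z y = ∑' x, P z x * Q n x y :=
    fun z => kpow_succ_left hP0 hPs hP1' hQ0 hQ n z y
  -- the double family f x z := μ x * P x z * Q n x y * Q (n+1) z y
  have hnn : ∀ x z, 0 ≤ μ x * P x z * Q n x y * Q (n + 1) z y := fun x z =>
    mul_nonneg (mul_nonneg (mul_nonneg (hμnn x) (hP0 x z)) (hQnn n x y)) (hQnn _ z y)
  have h1 : ∀ x, Summable fun z => μ x * P x z * Q n x y * Q (n + 1) z y := by
    intro x
    have : (fun z => μ x * P x z * Q n x y * Q (n + 1) z y) =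
        fun z => (μ x * Q n x y) * (P x z * Q (n + 1) z y) := by funext z; ring
    rw [this]
    exact (summable_kernel_mul_kpow hP0 hPs hP1' hQ0 hQ (n + 1) x y).mul_left _
  have hinner : ∀ x, ∑' z, μ x * P x z * Q n x y * Q (n + 1) z y =
      μ x * Q n x y * Q (n + 2) x y := by
    intro x
    have : (fun z => μ x * P x z * Q n x y * Q (n + 1) z y) =
        fun z => (μ x * Q n x y) * (P x z * Q (n + 1) z y) := by funext z; ring
    rw [this, tsum_mul_left, ← hG2 x]
  obtain ⟨hcol, -⟩ := summable_mu_mul_kpow hP0 hP1 hμ hm hrev hQ0 hQ n y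
  have h2 : Summable fun x => ∑' z, μ x * P x z * Q n x y * Q (n + 1) z y := by
    have : (fun x => ∑' z, μ x * P x z * Q n x y * Q (n + 1) z y) =
        fun x => μ x * Q n x y * Q (n + 2) x y := by funext x; exact hinner x
    rw [this]
    exact (hcol.mul_right (M / m)).of_nonneg_of_le
      (fun x => mul_nonneg (mul_nonneg (hμnn x) (hQnn n x y)) (hQnn _ x y))
      (fun x => by
        rw [mul_comm (μ x * Q n x y) (M / m), mul_comm (μ x * Q n x y) (Q (n + 2) x y)]
        exact mul_le_mul_of_nonneg_right (hB _ x) (mul_nonneg (hμnn x) (hQnn n x y)))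
  have hsum1 : Summable fun x => μ x * Q n x y * Q (n + 2) x y := by
    have : (fun x => μ x * Q n x y * Q (n + 2) x y) =
        fun x => ∑' z, μ x * P x z * Q n x y * Q (n + 1) z y := by funext x; exact (hinner x).symm
    rw [this]; exact h2
  refine ⟨hsum1, ?_⟩
  calc ∑' x, μ x * Q n x y * Q (n + 2) x y
      = ∑' x, ∑' z, μ x * P x z * Q n x y * Q (n + 1) z y := tsum_congr fun x => (hinner x).symm
    _ = ∑' z, ∑' x, μ x * P x z * Q n x y * Q (n + 1) z y := (tsum_swap_of_nonneg hnn h1 h2).symm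
    _ = ∑' z, μ z * Q (n + 1) z y ^ 2 := by
        refine tsum_congr fun z => ?_
        have : (fun x => μ x * P x z * Q n x y * Q (n + 1) z y) =
            fun x => (μ z * Q (n + 1) z y) * (P z x * Q n x y) := by
          funext x; rw [hrev x z]; ring
        rw [this, tsum_mul_left, ← hG1 z, sq]; ring

/-- **Energy identity** (Dirichlet form of `P²` along the column `G = Q n · y`):
`∑_x ∑_z μ_x Q² x z (G x − G z)² = 2 (∑_x μ_x G(x)² − ∑_x μ_x G₁(x)²)`, together with the
summability of the inner sums. [folklore] -/
theorem energy_identity (hP0 : ∀ x y, 0 ≤ P x y) (hP1 : ∀ x, HasSum (P x) 1)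
    (hμ : ∀ x, m ≤ μ x ∧ μ x ≤ M) (hm : 0 < m)
    (hrev : ∀ x y, μ x * P x y = μ y * P y x)
    (hQ0 : ∀ x y, Q 0 x y = if x = y then 1 else 0)
    (hQ : ∀ n x y, Q (n + 1) x y = ∑' z, Q n x z * P z y) (n : ℕ) (y : Fin d → ℤ) :
    (∀ x, Summable fun z => μ x * Q 2 x z * (Q n x y - Q n z y) ^ 2) ∧
    (Summable fun x => ∑' z, μ x * Q 2 x z * (Q n x y - Q n z y) ^ 2) ∧
    ∑' x, ∑' z, μ x * Q 2 x z * (Q n x y - Q n z y) ^ 2 =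
      2 * (∑' x, μ x * Q n x y ^ 2 - ∑' x, μ x * Q (n + 1) x y ^ 2) := by
  have hPs : ∀ x, Summable (P x) := fun x => (hP1 x).summable
  have hP1' : ∀ x, ∑' y, P x y ≤ 1 := fun x => ((hP1 x).tsum_eq).le
  have hμnn : ∀ x, 0 ≤ μ x := fun x => hm.le.trans (hμ x).1
  have hQnn : ∀ k x w, 0 ≤ Q k x w := kpow_nonneg hP0 hQ0 hQ
  have hB : ∀ k x, Q k x y ≤ M / m := fun k x => kpow_le_ratio hP0 hP1 hμ hm hrev hQ0 hQ k x y
  have hMm : 0 ≤ M / m := le_trans (hQnn 0 y y) (hB 0 y)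
  -- the two-step kernel
  have hQ2s : ∀ x, Summable (Q 2 x) := fun x => kpow_summable hP0 hPs hP1' hQ0 hQ 2 x
  have hQ21 : ∀ x, ∑' z, Q 2 x z = 1 := fun x => kpow_tsum_eq_one hP0 hP1 hQ0 hQ 2 x
  have hQ2rev : ∀ x z, μ x * Q 2 x z = μ z * Q 2 z x :=
    fun x z => kpow_reversible hP0 hPs hP1' hQ0 hQ hrev 2 x z
  -- G₂ via the two-step kernel
  have hG2 : ∀ x, Q (n + 2) x y = ∑' z, Q 2 x z * Q n z y := by
    intro x; rw [Nat.add_comm]; exact kpow_add hP0 hPs hP1' hQ0 hQ 2 n x y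
  set G : (Fin d → ℤ) → ℝ := fun x => Q n x y with hG
  -- summable pieces in z for fixed x
  have hz1 : ∀ x, Summable fun z => Q 2 x z * G z := fun x =>
    (hQ2s x).of_nonneg_of_le (fun z => mul_nonneg (hQnn 2 x z) (hQnn n z y))
      (fun z => mul_le_of_le_one_right (hQnn 2 x z) (kpow_le_one hP0 hPs hP1' hQ0 hQ n z y))
  have hz2 : ∀ x, Summable fun z => Q 2 x z * G z ^ 2 := fun x =>
    ((hz1 x).mul_left (M / m)).of_nonneg_of_le (fun z => mul_nonneg (hQnn 2 x z) (sq_nonneg _))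
      (fun z => by
        rw [sq, ← mul_assoc, mul_comm (M / m)]
        rw [mul_assoc, mul_assoc]
        exact mul_le_mul_of_nonneg_left (mul_le_mul_of_nonneg_left (hB n z) (hQnn n z y)) (hQnn 2 x z)
          |>.trans (le_of_eq (by ring)))
  -- inner sum
  have hinner_s : ∀ x, Summable fun z => μ x * Q 2 x z * (G x - G z) ^ 2 := by
    intro x
    have : (fun z => μ x * Q 2 x z * (G x - G z) ^ 2) = fun z =>
        μ x * G x ^ 2 * Q 2 x z - 2 * (μ x * G x) * (Q 2 x z * G z) + μ x * (Q 2 x z * G z ^ 2) := by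
      funext z; ring
    rw [this]
    exact (((hQ2s x).mul_left _).sub ((hz1 x).mul_left _)).add ((hz2 x).mul_left _)
  have hinner : ∀ x, ∑' z, μ x * Q 2 x z * (G x - G z) ^ 2 =
      μ x * G x ^ 2 - 2 * (μ x * G x * Q (n + 2) x y) + μ x * ∑' z, Q 2 x z * G z ^ 2 := by
    intro x
    have : (fun z => μ x * Q 2 x z * (G x - G z) ^ 2) = fun z =>
        (μ x * G x ^ 2 * Q 2 x z - 2 * (μ x * G x) * (Q 2 x z * G z)) + μ x * (Q 2 x z * G z ^ 2) := by
      funext z; ring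
    rw [this, Summable.tsum_add (((hQ2s x).mul_left _).sub ((hz1 x).mul_left _)) ((hz2 x).mul_left _),
      Summable.tsum_sub ((hQ2s x).mul_left _) ((hz1 x).mul_left _), tsum_mul_left, tsum_mul_left,
      tsum_mul_left, hQ21 x, mul_one, ← hG2 x]
    ring
  -- outer summability
  obtain ⟨hcol, -⟩ := summable_mu_mul_kpow hP0 hP1 hμ hm hrev hQ0 hQ n y
  obtain ⟨hcol2, -⟩ := summable_mu_mul_kpow hP0 hP1 hμ hm hrev hQ0 hQ (n + 2) y
  obtain ⟨hcross_s, hcross⟩ := tsum_mu_mul_kpow_mul_kpow_two hP0 hP1 hμ hm hrev hQ0 hQ n y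
  have hsq_s : ∀ k, Summable fun x => μ x * Q k x y ^ 2 := by
    intro k
    obtain ⟨hck, -⟩ := summable_mu_mul_kpow hP0 hP1 hμ hm hrev hQ0 hQ k y
    refine (hck.mul_left (M / m)).of_nonneg_of_le (fun x => mul_nonneg (hμnn x) (sq_nonneg _))
      (fun x => ?_)
    rw [sq, ← mul_assoc, mul_comm (M / m), mul_assoc, mul_assoc]
    exact (mul_le_mul_of_nonneg_left (mul_le_mul_of_nonneg_left (hB k x) (hQnn k x y)) (hμnn x)).trans
      (le_of_eq (by ring))
  -- the third piece: ∑_x μ_x ∑_z Q 2 x z G z² = ∑_z μ_z G z²  (column sums)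
  have hnn3 : ∀ x z, 0 ≤ μ x * (Q 2 x z * G z ^ 2) := fun x z =>
    mul_nonneg (hμnn x) (mul_nonneg (hQnn 2 x z) (sq_nonneg _))
  have h31 : ∀ x, Summable fun z => μ x * (Q 2 x z * G z ^ 2) := fun x => (hz2 x).mul_left _
  have h3swap_s : ∀ z, Summable fun x => μ x * (Q 2 x z * G z ^ 2) := by
    intro z
    have : (fun x => μ x * (Q 2 x z * G z ^ 2)) = fun x => (μ z * G z ^ 2) * Q 2 z x := by
      funext x; rw [← mul_assoc, hQ2rev x z]; ring
    rw [this]; exact (hQ2s z).mul_left _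
  have h3swap : ∀ z, ∑' x, μ x * (Q 2 x z * G z ^ 2) = μ z * G z ^ 2 := by
    intro z
    have : (fun x => μ x * (Q 2 x z * G z ^ 2)) = fun x => (μ z * G z ^ 2) * Q 2 z x := by
      funext x; rw [← mul_assoc, hQ2rev x z]; ring
    rw [this, tsum_mul_left, hQ21 z, mul_one]
  -- summability of x ↦ μ x * ∑_z ... via the transposed family
  have h32 : Summable fun x => ∑' z, μ x * (Q 2 x z * G z ^ 2) := by
    -- use Tonelli in the other direction: z-sections summable in x, and z ↦ ∑_x = μ z G z² summable
    have hT := summable_swap_of_nonneg (fun z x => hnn3 x z) h3swap_s (by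
      have : (fun z => ∑' x, μ x * (Q 2 x z * G z ^ 2)) = fun z => μ z * G z ^ 2 := by
        funext z; exact h3swap z
      rw [this]; exact hsq_s n)
    exact hT.2
  have h3 : ∑' x, μ x * ∑' z, Q 2 x z * G z ^ 2 = ∑' x, μ x * G x ^ 2 := by
    calc ∑' x, μ x * ∑' z, Q 2 x z * G z ^ 2 = ∑' x, ∑' z, μ x * (Q 2 x z * G z ^ 2) :=
          tsum_congr fun x => (tsum_mul_left).symm
      _ = ∑' z, ∑' x, μ x * (Q 2 x z * G z ^ 2) := (tsum_swap_of_nonneg hnn3 h31 h32).symm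
          |> fun h => by
            rw [tsum_swap_of_nonneg (fun z x => hnn3 x z) h3swap_s (by
              have : (fun z => ∑' x, μ x * (Q 2 x z * G z ^ 2)) = fun z => μ z * G z ^ 2 := by
                funext z; exact h3swap z
              rw [this]; exact hsq_s n)]
      _ = ∑' z, μ z * G z ^ 2 := tsum_congr h3swap
  -- assemble
  have hout_fun : (fun x => ∑' z, μ x * Q 2 x z * (G x - G z) ^ 2) = fun x =>
      (μ x * G x ^ 2 - 2 * (μ x * G x * Q (n + 2) x y)) + μ x * ∑' z, Q 2 x z * G z ^ 2 := by
    funext x; exact hinner x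
  have h32' : Summable fun x => μ x * ∑' z, Q 2 x z * G z ^ 2 := by
    have : (fun x => μ x * ∑' z, Q 2 x z * G z ^ 2) = fun x => ∑' z, μ x * (Q 2 x z * G z ^ 2) := by
      funext x; exact (tsum_mul_left).symm
    rw [this]; exact h32
  have hout_s : Summable fun x => ∑' z, μ x * Q 2 x z * (G x - G z) ^ 2 := by
    rw [hout_fun]
    exact ((hsq_s n).sub (hcross_s.mul_left 2)).add h32'
  refine ⟨hinner_s, hout_s, ?_⟩
  rw [hout_fun, Summable.tsum_add ((hsq_s n).sub (hcross_s.mul_left 2)) h32',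
    Summable.tsum_sub (hsq_s n) (hcross_s.mul_left 2), tsum_mul_left, hcross, h3]
  ring

/-- The weighted `ℓ²` norms `u n = ∑_x μ_x (Q n x y)²` are nonincreasing in `n`. [folklore] -/
theorem tsum_mu_kpow_sq_antitone (hP0 : ∀ x y, 0 ≤ P x y) (hP1 : ∀ x, HasSum (P x) 1)
    (hμ : ∀ x, m ≤ μ x ∧ μ x ≤ M) (hm : 0 < m)
    (hrev : ∀ x y, μ x * P x y = μ y * P y x)
    (hQ0 : ∀ x y, Q 0 x y = if x = y then 1 else 0)
    (hQ : ∀ n x y, Q (n + 1) x y = ∑' z, Q n x z * P z y) (n : ℕ) (y : Fin d → ℤ) :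
    ∑' x, μ x * Q (n + 1) x y ^ 2 ≤ ∑' x, μ x * Q n x y ^ 2 := by
  obtain ⟨-, -, hid⟩ := energy_identity hP0 hP1 hμ hm hrev hQ0 hQ n y
  have hμnn : ∀ x, 0 ≤ μ x := fun x => hm.le.trans (hμ x).1
  have hQnn : ∀ k x w, 0 ≤ Q k x w := kpow_nonneg hP0 hQ0 hQ
  have hD : 0 ≤ ∑' x, ∑' z, μ x * Q 2 x z * (Q n x y - Q n z y) ^ 2 :=
    tsum_nonneg fun x => tsum_nonneg fun z =>
      mul_nonneg (mul_nonneg (hμnn x) (hQnn 2 x z)) (sq_nonneg _)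
  linarith

/-- **The Nash difference inequality.** With `u n = ∑_x μ_x (Q n x y)²`, for every integer
`r ≥ 1`: `(m c' / 4) r^{-α} (u n / M − 2 (M/m)² r^{-d}) ≤ u n − u (n+1)`, where
`c' = c₁² 2^{-(d+α)}` is the two-step constant. [folklore] -/
theorem nash_difference_ineq (hd : 1 ≤ d) (hα : 0 < α) (hP0 : ∀ x y, 0 ≤ P x y)
    (hP1 : ∀ x, HasSum (P x) 1)
    (hμ : ∀ x, m ≤ μ x ∧ μ x ≤ M) (hm : 0 < m)
    (hrev : ∀ x y, μ x * P x y = μ y * P y x)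
    (hlb : ∀ x y, c₁ * ‖x - y‖ ^ (-((d : ℝ) + α)) ≤ P x y) (hc₁ : 0 < c₁)
    (hQ0 : ∀ x y, Q 0 x y = if x = y then 1 else 0)
    (hQ : ∀ n x y, Q (n + 1) x y = ∑' z, Q n x z * P z y) (n : ℕ) (y : Fin d → ℤ)
    {r : ℕ} (hr : 1 ≤ r) :
    m * (c₁ ^ 2 * (2 : ℝ) ^ (-((d : ℝ) + α))) / 4 * (r : ℝ) ^ (-α) *
        (M⁻¹ * ∑' x, μ x * Q n x y ^ 2 - 2 * (M / m) ^ 2 * (r : ℝ) ^ (-(d : ℝ))) ≤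
      ∑' x, μ x * Q n x y ^ 2 - ∑' x, μ x * Q (n + 1) x y ^ 2 := by
  have hPs : ∀ x, Summable (P x) := fun x => (hP1 x).summable
  have hP1' : ∀ x, ∑' y, P x y ≤ 1 := fun x => ((hP1 x).tsum_eq).le
  have hμnn : ∀ x, 0 ≤ μ x := fun x => hm.le.trans (hμ x).1
  have hμpos : ∀ x, 0 < μ x := fun x => lt_of_lt_of_le hm (hμ x).1
  have hM : 0 < M := lt_of_lt_of_le hm ((hμ y).1.trans (hμ y).2)
  have hQnn : ∀ k x w, 0 ≤ Q k x w := kpow_nonneg hP0 hQ0 hQ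
  set s : ℝ := (d : ℝ) + α with hs
  set c' : ℝ := c₁ ^ 2 * (2 : ℝ) ^ (-s) with hc'
  have hc'pos : 0 < c' := by rw [hc']; positivity
  set G : (Fin d → ℤ) → ℝ := fun x => Q n x y with hG
  set u : ℝ := ∑' x, μ x * Q n x y ^ 2 with hu
  set u' : ℝ := ∑' x, μ x * Q (n + 1) x y ^ 2 with hu'
  obtain ⟨hinner_s, hout_s, hid⟩ := energy_identity hP0 hP1 hμ hm hrev hQ0 hQ n y
  obtain ⟨hGs, hG1⟩ := summable_kpow_col hP0 hP1 hμ hm hrev hQ0 hQ n y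
  have hGabs_s : Summable fun x => |G x| := hGs.congr (fun x => (abs_of_nonneg (hQnn n x y)).symm)
  have hGabs : ∑' x, |G x| ≤ M / m := by
    rw [tsum_congr (fun x => abs_of_nonneg (hQnn n x y))]; exact hG1
  have hG2s : Summable fun x => G x ^ 2 := summable_sq_of_summable_abs hGabs_s
  -- Nash
  set B : Finset (Fin d → ℤ) := Fintype.piFinset (fun _ : Fin d => Finset.Icc (-(r : ℤ)) r) with hB
  have hnash := nash_parametrized hα hGabs_s hr
  -- energy comparison: box form ≤ (1/(m c')) Dirichlet form of P²
  have hEpt : ∀ x, ∑ h ∈ B.erase 0, ‖h‖ ^ (-s) * (G x - G (x + h)) ^ 2 ≤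
      (m * c')⁻¹ * ∑' z, μ x * Q 2 x z * (G x - G z) ^ 2 := by
    intro x
    have hterm : ∀ h ∈ B.erase 0, ‖h‖ ^ (-s) * (G x - G (x + h)) ^ 2 ≤
        (m * c')⁻¹ * (μ x * Q 2 x (x + h) * (G x - G (x + h)) ^ 2) := by
      intro h hh
      have hne : x ≠ x + h := by
        intro he
        exact (Finset.mem_erase.mp hh).1 (by simpa using he.symm)
      have hlow := kpow_two_lower hd hα hP0 hP1 hlb hc₁.le hQ0 hQ hne
      rw [show x - (x + h) = -h by abel, norm_neg] at hlow
      -- c' ‖h‖^{-s} ≤ Q 2 x (x+h), and m ≤ μ x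
      have hk : ‖h‖ ^ (-s) ≤ (m * c')⁻¹ * (μ x * Q 2 x (x + h)) := by
        rw [inv_mul_eq_div, le_div_iff₀ (by positivity)]
        calc ‖h‖ ^ (-s) * (m * c') = m * (c' * ‖h‖ ^ (-s)) := by ring
          _ ≤ μ x * Q 2 x (x + h) := mul_le_mul (hμ x).1 (by rw [hc']; exact hlow)
              (by positivity) (hμnn x)
      calc ‖h‖ ^ (-s) * (G x - G (x + h)) ^ 2
          ≤ ((m * c')⁻¹ * (μ x * Q 2 x (x + h))) * (G x - G (x + h)) ^ 2 :=
            mul_le_mul_of_nonneg_right hk (sq_nonneg _)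
        _ = (m * c')⁻¹ * (μ x * Q 2 x (x + h) * (G x - G (x + h)) ^ 2) := by ring
    calc ∑ h ∈ B.erase 0, ‖h‖ ^ (-s) * (G x - G (x + h)) ^ 2
        ≤ ∑ h ∈ B.erase 0, (m * c')⁻¹ * (μ x * Q 2 x (x + h) * (G x - G (x + h)) ^ 2) :=
          Finset.sum_le_sum hterm
      _ = (m * c')⁻¹ * ∑ h ∈ B.erase 0, μ x * Q 2 x (x + h) * (G x - G (x + h)) ^ 2 := by
          rw [Finset.mul_sum]
      _ ≤ (m * c')⁻¹ * ∑' z, μ x * Q 2 x z * (G x - G z) ^ 2 := by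
          refine mul_le_mul_of_nonneg_left ?_ (by positivity)
          have : ∑ h ∈ B.erase 0, μ x * Q 2 x (x + h) * (G x - G (x + h)) ^ 2 =
              ∑ z ∈ (B.erase 0).map (Equiv.addLeft x).toEmbedding,
                μ x * Q 2 x z * (G x - G z) ^ 2 := by
            rw [Finset.sum_map]; rfl
          rw [this]
          exact (hinner_s x).sum_le_tsum _ (fun z _ =>
            mul_nonneg (mul_nonneg (hμnn x) (hQnn 2 x z)) (sq_nonneg _))
  have hE_s : Summable fun x => ∑ h ∈ B.erase 0, ‖h‖ ^ (-s) * (G x - G (x + h)) ^ 2 :=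
    summable_energy_finset hG2s _ (fun h => ‖h‖ ^ (-s)) (fun h => Real.rpow_nonneg (norm_nonneg _) _)
  have hE : ∑' x, ∑ h ∈ B.erase 0, ‖h‖ ^ (-s) * (G x - G (x + h)) ^ 2 ≤
      (m * c')⁻¹ * (2 * (u - u')) := by
    calc _ ≤ ∑' x, (m * c')⁻¹ * ∑' z, μ x * Q 2 x z * (G x - G z) ^ 2 :=
          Summable.tsum_le_tsum hEpt hE_s (hout_s.mul_left _)
      _ = (m * c')⁻¹ * (2 * (u - u')) := by rw [tsum_mul_left, hid]
  -- ℓ² lower bound: u ≤ M ∑ G²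
  have huG : u ≤ M * ∑' x, G x ^ 2 := by
    rw [← tsum_mul_left]
    refine Summable.tsum_le_tsum (fun x => ?_) ?_ (hG2s.mul_left M)
    · exact mul_le_mul_of_nonneg_right (hμ x).2 (sq_nonneg _)
    · obtain ⟨hck, -⟩ := summable_mu_mul_kpow hP0 hP1 hμ hm hrev hQ0 hQ n y
      have hBnd : ∀ x, Q n x y ≤ M / m := fun x => kpow_le_ratio hP0 hP1 hμ hm hrev hQ0 hQ n x y
      refine (hck.mul_left (M / m)).of_nonneg_of_le (fun x => mul_nonneg (hμnn x) (sq_nonneg _))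
        (fun x => ?_)
      rw [sq, ← mul_assoc, mul_comm (M / m), mul_assoc, mul_assoc]
      exact (mul_le_mul_of_nonneg_left (mul_le_mul_of_nonneg_left (hBnd x) (hQnn n x y)) (hμnn x)).trans
        (le_of_eq (by ring))
  -- combine Nash, hE, hGabs, huG
  have hr0 : (0 : ℝ) < r := by exact_mod_cast hr
  have hN : ((2 * (r : ℝ) + 1) ^ d)⁻¹ ≤ (r : ℝ) ^ (-(d : ℝ)) := by
    rw [Real.rpow_neg hr0.le, Real.rpow_natCast]
    exact inv_anti₀ (pow_pos hr0 d) (pow_le_pow_left₀ hr0.le (by linarith) d)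
  have hmain : M⁻¹ * u - 2 * (M / m) ^ 2 * (r : ℝ) ^ (-(d : ℝ)) ≤
      2 * (r : ℝ) ^ α * ((m * c')⁻¹ * (2 * (u - u'))) := by
    have h1 : M⁻¹ * u ≤ ∑' x, G x ^ 2 := by
      rw [inv_mul_le_iff₀ hM]; exact huG
    have h2 : (∑' x, |G x|) ^ 2 ≤ (M / m) ^ 2 :=
      pow_le_pow_left₀ (tsum_nonneg fun x => abs_nonneg _) hGabs 2
    have h3 : 2 / ((2 * (r : ℝ) + 1) ^ d) * (∑' x, |G x|) ^ 2 ≤ 2 * (M / m) ^ 2 * (r : ℝ) ^ (-(d : ℝ)) := by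
      rw [div_eq_mul_inv]
      calc 2 * ((2 * (r : ℝ) + 1) ^ d)⁻¹ * (∑' x, |G x|) ^ 2 ≤ 2 * (r : ℝ) ^ (-(d : ℝ)) * (M / m) ^ 2 :=
            mul_le_mul (mul_le_mul_of_nonneg_left hN (by norm_num)) h2 (sq_nonneg _) (by positivity)
        _ = 2 * (M / m) ^ 2 * (r : ℝ) ^ (-(d : ℝ)) := by ring
    have h4 : 2 * (r : ℝ) ^ α * ∑' x, ∑ h ∈ B.erase 0, ‖h‖ ^ (-s) * (G x - G (x + h)) ^ 2 ≤
        2 * (r : ℝ) ^ α * ((m * c')⁻¹ * (2 * (u - u'))) :=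
      mul_le_mul_of_nonneg_left hE (by positivity)
    have hnash' : ∑' x, G x ^ 2 ≤ 2 * (r : ℝ) ^ α * ∑' x, ∑ h ∈ B.erase 0,
        ‖h‖ ^ (-((d : ℝ) + α)) * (G x - G (x + h)) ^ 2 + 2 / ((2 * (r : ℝ) + 1) ^ d) * (∑' x, |G x|) ^ 2 :=
      hnash
    rw [← hs] at hnash'
    linarith
  -- multiply by (m c'/4) r^{-α}
  have hfac : 0 ≤ m * c' / 4 * (r : ℝ) ^ (-α) := by positivity
  have hkey : m * c' / 4 * (r : ℝ) ^ (-α) * (2 * (r : ℝ) ^ α * ((m * c')⁻¹ * (2 * (u - u')))) = u - u' := by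
    have h1 : (r : ℝ) ^ (-α) * (r : ℝ) ^ α = 1 := by
      rw [← Real.rpow_add hr0, neg_add_cancel, Real.rpow_zero]
    have h2 : (m * c') * (m * c')⁻¹ = 1 := mul_inv_cancel₀ (by positivity)
    calc m * c' / 4 * (r : ℝ) ^ (-α) * (2 * (r : ℝ) ^ α * ((m * c')⁻¹ * (2 * (u - u'))))
        = ((r : ℝ) ^ (-α) * (r : ℝ) ^ α) * ((m * c') * (m * c')⁻¹) * (u - u') := by ring
      _ = u - u' := by rw [h1, h2]; ring
  calc m * c' / 4 * (r : ℝ) ^ (-α) * (M⁻¹ * u - 2 * (M / m) ^ 2 * (r : ℝ) ^ (-(d : ℝ)))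
      ≤ m * c' / 4 * (r : ℝ) ^ (-α) * (2 * (r : ℝ) ^ α * ((m * c')⁻¹ * (2 * (u - u')))) :=
        mul_le_mul_of_nonneg_left hmain hfac
    _ = u - u' := hkey

/-- **Decay of the weighted `ℓ²` norm of the columns**: `∑_x μ_x (Q n x y)² ≤ C n^{-d/α}` for
`n ≥ 1`, with `C` depending only on `d, α, m, M, c₁`. [folklore] -/
theorem tsum_mu_kpow_sq_le (hd : 1 ≤ d) (hα : 0 < α) (hP0 : ∀ x y, 0 ≤ P x y)
    (hP1 : ∀ x, HasSum (P x) 1)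
    (hμ : ∀ x, m ≤ μ x ∧ μ x ≤ M) (hm : 0 < m)
    (hrev : ∀ x y, μ x * P x y = μ y * P y x)
    (hlb : ∀ x y, c₁ * ‖x - y‖ ^ (-((d : ℝ) + α)) ≤ P x y) (hc₁ : 0 < c₁)
    (hQ0 : ∀ x y, Q 0 x y = if x = y then 1 else 0)
    (hQ : ∀ n x y, Q (n + 1) x y = ∑' z, Q n x z * P z y) :
    ∃ C : ℝ, 0 < C ∧ ∀ (n : ℕ) (y : Fin d → ℤ), 1 ≤ n →
      ∑' x, μ x * Q n x y ^ 2 ≤ C * (n : ℝ) ^ (-(d : ℝ) / α) := by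
  have hμnn : ∀ x, 0 ≤ μ x := fun x => hm.le.trans (hμ x).1
  have hM : 0 < M := lt_of_lt_of_le hm ((hμ 0).1.trans (hμ 0).2)
  have hQnn : ∀ k x w, 0 ≤ Q k x w := kpow_nonneg hP0 hQ0 hQ
  have hdpos : (0 : ℝ) < d := by exact_mod_cast hd
  -- constants of the difference inequality
  set a : ℝ := m * (c₁ ^ 2 * (2 : ℝ) ^ (-((d : ℝ) + α))) / 4 with ha
  set b : ℝ := M⁻¹ with hb
  set e : ℝ := 2 * (M / m) ^ 2 with he
  set U : ℝ := M * (M / m) with hU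
  have hapos : 0 < a := by rw [ha]; positivity
  have hbpos : 0 < b := by rw [hb]; positivity
  have hepos : 0 < e := by rw [he]; positivity
  set κ₀ : ℝ := a * (2 : ℝ) ^ (-α) * (b / 2) * (b / (2 * e * max 1 (b * U / (2 * e)))) ^ (α / d)
    with hκ₀
  have hκ₀pos : 0 < κ₀ := by rw [hκ₀]; positivity
  set p : ℝ := α / d with hp
  have hppos : 0 < p := by rw [hp]; positivity
  refine ⟨(p * κ₀) ^ (-(1 / p)), Real.rpow_pos_of_pos (by positivity) _, fun n y hn => ?_⟩
  -- the sequence u k := ∑_x μ_x (Q k x y)²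
  set u : ℕ → ℝ := fun k => ∑' x, μ x * Q k x y ^ 2 with hu
  have hu0 : ∀ k, 0 ≤ u k := fun k => tsum_nonneg fun x => mul_nonneg (hμnn x) (sq_nonneg _)
  have humono : ∀ k, u (k + 1) ≤ u k := fun k =>
    tsum_mu_kpow_sq_antitone hP0 hP1 hμ hm hrev hQ0 hQ k y
  have huU : ∀ k, u k ≤ U := by
    intro k
    obtain ⟨hck, hle⟩ := summable_mu_mul_kpow hP0 hP1 hμ hm hrev hQ0 hQ k y
    have hBnd : ∀ x, Q k x y ≤ M / m := fun x => kpow_le_ratio hP0 hP1 hμ hm hrev hQ0 hQ k x y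
    calc u k ≤ ∑' x, (M / m) * (μ x * Q k x y) := by
          refine Summable.tsum_le_tsum (fun x => ?_) ?_ (hck.mul_left _)
          · rw [sq, ← mul_assoc, mul_comm (M / m), mul_assoc, mul_assoc]
            exact (mul_le_mul_of_nonneg_left (mul_le_mul_of_nonneg_left (hBnd x) (hQnn k x y))
              (hμnn x)).trans (le_of_eq (by ring))
          · refine (hck.mul_left (M / m)).of_nonneg_of_le (fun x => mul_nonneg (hμnn x) (sq_nonneg _))
              (fun x => ?_)
            rw [sq, ← mul_assoc, mul_comm (M / m), mul_assoc, mul_assoc]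
            exact (mul_le_mul_of_nonneg_left (mul_le_mul_of_nonneg_left (hBnd x) (hQnn k x y))
              (hμnn x)).trans (le_of_eq (by ring))
      _ = (M / m) * ∑' x, μ x * Q k x y := tsum_mul_left
      _ ≤ (M / m) * M := mul_le_mul_of_nonneg_left hle (by positivity)
      _ = U := by rw [hU]; ring
  have hstep : ∀ k, κ₀ * u k ^ (1 + p) ≤ u k - u (k + 1) := by
    intro k
    have H : ∀ r : ℕ, 1 ≤ r → a * (r : ℝ) ^ (-α) * (b * u k - e * (r : ℝ) ^ (-(d : ℝ))) ≤ u k - u (k + 1) := by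
      intro r hr
      have := nash_difference_ineq hd hα hP0 hP1 hμ hm hrev hlb hc₁ hQ0 hQ k y hr
      rw [ha, hb, he]
      convert this using 2
    have := step_of_parametrized hapos hbpos hepos hα hdpos (hu0 k) (huU k) (humono k) H
    rw [hκ₀, hp]
    exact this
  have hdec := seq_decay hppos hκ₀pos hu0 humono hstep hn
  -- (p κ₀ n)^{-1/p} = (p κ₀)^{-1/p} n^{-d/α}
  have hn0 : (0 : ℝ) < n := by exact_mod_cast hn
  calc u n ≤ (p * κ₀ * n) ^ (-(1 / p)) := hdec
    _ = (p * κ₀) ^ (-(1 / p)) * (n : ℝ) ^ (-(d : ℝ) / α) := by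
        rw [Real.mul_rpow (by positivity) hn0.le]
        congr 1
        rw [hp]
        congr 1
        field_simp

/-- **On-diagonal (uniform) upper bound** — Bass–Levin Thm 4.3 in discrete form: for a
reversible stable-like Markov kernel on `ℤ^d`, `Q n x y ≤ C n^{-d/α}` for all `n ≥ 1`, `x, y`.
[cite: BassLevin2002, Thm 4.3] -/
theorem kpow_diag_bound (hd : 1 ≤ d) (hα : 0 < α) (hP0 : ∀ x y, 0 ≤ P x y)
    (hP1 : ∀ x, HasSum (P x) 1)
    (hμ : ∀ x, m ≤ μ x ∧ μ x ≤ M) (hm : 0 < m)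
    (hrev : ∀ x y, μ x * P x y = μ y * P y x)
    (hlb : ∀ x y, c₁ * ‖x - y‖ ^ (-((d : ℝ) + α)) ≤ P x y) (hc₁ : 0 < c₁)
    (hQ0 : ∀ x y, Q 0 x y = if x = y then 1 else 0)
    (hQ : ∀ n x y, Q (n + 1) x y = ∑' z, Q n x z * P z y) :
    ∃ C : ℝ, 0 < C ∧ ∀ (n : ℕ) (x y : Fin d → ℤ), 1 ≤ n →
      Q n x y ≤ C * (n : ℝ) ^ (-(d : ℝ) / α) := by
  have hPs : ∀ x, Summable (P x) := fun x => (hP1 x).summable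
  have hP1' : ∀ x, ∑' y, P x y ≤ 1 := fun x => ((hP1 x).tsum_eq).le
  have hμnn : ∀ x, 0 ≤ μ x := fun x => hm.le.trans (hμ x).1
  have hμpos : ∀ x, 0 < μ x := fun x => lt_of_lt_of_le hm (hμ x).1
  have hM : 0 < M := lt_of_lt_of_le hm ((hμ 0).1.trans (hμ 0).2)
  have hQnn : ∀ k x w, 0 ≤ Q k x w := kpow_nonneg hP0 hQ0 hQ
  obtain ⟨C₀, hC₀, hcol⟩ := tsum_mu_kpow_sq_le hd hα hP0 hP1 hμ hm hrev hlb hc₁ hQ0 hQ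
  set q : ℝ := (d : ℝ) / α with hq
  have hqpos : 0 < q := by rw [hq]; positivity
  -- column ℓ² bound
  have hcol2 : ∀ n (y : Fin d → ℤ), 1 ≤ n → (Summable fun x => Q n x y ^ 2) ∧
      ∑' x, Q n x y ^ 2 ≤ m⁻¹ * C₀ * (n : ℝ) ^ (-q) := by
    intro n y hn
    obtain ⟨hck, -⟩ := summable_mu_mul_kpow hP0 hP1 hμ hm hrev hQ0 hQ n y
    have hBnd : ∀ x, Q n x y ≤ M / m := fun x => kpow_le_ratio hP0 hP1 hμ hm hrev hQ0 hQ n x y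
    have hsq_s : Summable fun x => μ x * Q n x y ^ 2 := by
      refine (hck.mul_left (M / m)).of_nonneg_of_le (fun x => mul_nonneg (hμnn x) (sq_nonneg _))
        (fun x => ?_)
      rw [sq, ← mul_assoc, mul_comm (M / m), mul_assoc, mul_assoc]
      exact (mul_le_mul_of_nonneg_left (mul_le_mul_of_nonneg_left (hBnd x) (hQnn n x y))
        (hμnn x)).trans (le_of_eq (by ring))
    have hpt : ∀ x, Q n x y ^ 2 ≤ m⁻¹ * (μ x * Q n x y ^ 2) := by
      intro x
      rw [← mul_assoc]
      refine le_mul_of_one_le_left (sq_nonneg _) ?_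
      rw [inv_mul_eq_div, one_le_div hm]; exact (hμ x).1
    have hs : Summable fun x => Q n x y ^ 2 := (hsq_s.mul_left _).of_nonneg_of_le (fun x => sq_nonneg _) hpt
    refine ⟨hs, ?_⟩
    calc ∑' x, Q n x y ^ 2 ≤ ∑' x, m⁻¹ * (μ x * Q n x y ^ 2) := Summable.tsum_le_tsum hpt hs (hsq_s.mul_left _)
      _ = m⁻¹ * ∑' x, μ x * Q n x y ^ 2 := tsum_mul_left
      _ ≤ m⁻¹ * (C₀ * (n : ℝ) ^ (-q)) := by
          have := hcol n y hn
          rw [neg_div] at this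
          rw [hq]
          exact mul_le_mul_of_nonneg_left this (inv_nonneg.mpr hm.le)
      _ = m⁻¹ * C₀ * (n : ℝ) ^ (-q) := by ring
  -- row ℓ² bound via reversibility
  have hrow2 : ∀ n (x : Fin d → ℤ), 1 ≤ n → (Summable fun z => Q n x z ^ 2) ∧
      ∑' z, Q n x z ^ 2 ≤ (M / m) ^ 2 * (m⁻¹ * C₀ * (n : ℝ) ^ (-q)) := by
    intro n x hn
    obtain ⟨hs, hle⟩ := hcol2 n x hn
    have hrel : ∀ z, Q n x z ≤ (M / m) * Q n z x := by
      intro z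
      have hr := kpow_reversible hP0 hPs hP1' hQ0 hQ hrev n x z
      have : Q n x z = (μ z / μ x) * Q n z x := by
        rw [div_mul_eq_mul_div, eq_div_iff (hμpos x).ne']
        calc Q n x z * μ x = μ x * Q n x z := mul_comm _ _
          _ = μ z * Q n z x := hr
      rw [this]
      refine mul_le_mul_of_nonneg_right ?_ (hQnn n z x)
      exact div_le_div₀ hM.le (hμ z).2 hm (hμ x).1
    have hpt : ∀ z, Q n x z ^ 2 ≤ (M / m) ^ 2 * Q n z x ^ 2 := by
      intro z
      rw [← mul_pow]
      exact pow_le_pow_left₀ (hQnn n x z) (hrel z) 2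
    have hs' : Summable fun z => Q n x z ^ 2 :=
      (hs.mul_left _).of_nonneg_of_le (fun z => sq_nonneg _) hpt
    refine ⟨hs', ?_⟩
    calc ∑' z, Q n x z ^ 2 ≤ ∑' z, (M / m) ^ 2 * Q n z x ^ 2 := Summable.tsum_le_tsum hpt hs' (hs.mul_left _)
      _ = (M / m) ^ 2 * ∑' z, Q n z x ^ 2 := tsum_mul_left
      _ ≤ (M / m) ^ 2 * (m⁻¹ * C₀ * (n : ℝ) ^ (-q)) := mul_le_mul_of_nonneg_left hle (sq_nonneg _)
  -- even times: AM–GM in Chapman–Kolmogorov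
  set C' : ℝ := ((M / m) ^ 2 + 1) / 2 * (m⁻¹ * C₀) with hC'
  have hC'pos : 0 < C' := by rw [hC']; positivity
  have heven : ∀ n (x y : Fin d → ℤ), 1 ≤ n → Q (n + n) x y ≤ C' * (n : ℝ) ^ (-q) := by
    intro n x y hn
    obtain ⟨hrs, hrle⟩ := hrow2 n x hn
    obtain ⟨hcs, hcle⟩ := hcol2 n y hn
    rw [kpow_add hP0 hPs hP1' hQ0 hQ n n x y]
    have hpt : ∀ z, Q n x z * Q n z y ≤ (Q n x z ^ 2 + Q n z y ^ 2) / 2 := by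
      intro z; nlinarith [sq_nonneg (Q n x z - Q n z y)]
    calc ∑' z, Q n x z * Q n z y ≤ ∑' z, (Q n x z ^ 2 + Q n z y ^ 2) / 2 :=
          Summable.tsum_le_tsum hpt (summable_kpow_mul_kpow hP0 hPs hP1' hQ0 hQ n n x y)
            ((hrs.add hcs).div_const 2)
      _ = (∑' z, Q n x z ^ 2 + ∑' z, Q n z y ^ 2) / 2 := by
          rw [tsum_div_const, Summable.tsum_add hrs hcs]
      _ ≤ ((M / m) ^ 2 * (m⁻¹ * C₀ * (n : ℝ) ^ (-q)) + m⁻¹ * C₀ * (n : ℝ) ^ (-q)) / 2 := by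
          gcongr
      _ = C' * (n : ℝ) ^ (-q) := by rw [hC']; ring
  -- all times
  refine ⟨max 1 (C' * (3 : ℝ) ^ q), lt_of_lt_of_le one_pos (le_max_left _ _), fun N x y hN => ?_⟩
  have hN0 : (0 : ℝ) < N := by exact_mod_cast hN
  have hNq : 0 < (N : ℝ) ^ (-q) := Real.rpow_pos_of_pos hN0 _
  -- comparison n^{-q} ≤ 3^q N^{-q} when 3 n ≥ N
  have hcmp : ∀ n : ℕ, 1 ≤ n → N ≤ 3 * n → (n : ℝ) ^ (-q) ≤ (3 : ℝ) ^ q * (N : ℝ) ^ (-q) := by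
    intro n hn h3
    have hn0 : (0 : ℝ) < n := by exact_mod_cast hn
    have hle : (N : ℝ) / 3 ≤ n := by
      rw [div_le_iff₀ (by norm_num : (0 : ℝ) < 3)]; exact_mod_cast (by linarith : N ≤ n * 3)
    calc (n : ℝ) ^ (-q) ≤ ((N : ℝ) / 3) ^ (-q) := Real.rpow_le_rpow_of_nonpos (by positivity) hle (by linarith)
      _ = (3 : ℝ) ^ q * (N : ℝ) ^ (-q) := by
          rw [Real.div_rpow hN0.le (by norm_num), Real.rpow_neg (by norm_num : (0 : ℝ) ≤ 3),
            div_inv_eq_mul, mul_comm]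
  rcases Nat.even_or_odd N with ⟨n, rfl⟩ | ⟨n, rfl⟩
  · -- N = n + n
    have hn : 1 ≤ n := by omega
    calc Q (n + n) x y ≤ C' * (n : ℝ) ^ (-q) := heven n x y hn
      _ ≤ C' * ((3 : ℝ) ^ q * ((n + n : ℕ) : ℝ) ^ (-q)) :=
          mul_le_mul_of_nonneg_left (hcmp n hn (by omega)) hC'pos.le
      _ = (C' * (3 : ℝ) ^ q) * ((n + n : ℕ) : ℝ) ^ (-q) := by ring
      _ ≤ max 1 (C' * (3 : ℝ) ^ q) * ((n + n : ℕ) : ℝ) ^ (-(d : ℝ) / α) := by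
          rw [hq, neg_div]
          exact mul_le_mul_of_nonneg_right (le_max_right _ _) hNq.le
  · -- N = 2 n + 1
    rcases Nat.eq_zero_or_pos n with hn0 | hnpos
    · -- N = 1
      subst hn0
      simp only [Nat.mul_zero, Nat.zero_add, Nat.cast_one, Real.one_rpow, mul_one]
      exact (kpow_le_one hP0 hPs hP1' hQ0 hQ 1 x y).trans (le_max_left _ _)
    · have hn : 1 ≤ n := hnpos
      have hrec : Q (2 * n + 1) x y = ∑' z, P x z * Q (n + n) z y := by
        rw [show 2 * n + 1 = (n + n) + 1 by ring]
        exact kpow_succ_left hP0 hPs hP1' hQ0 hQ (n + n) x y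
      have hbd : ∑' z, P x z * Q (n + n) z y ≤ C' * (n : ℝ) ^ (-q) := by
        calc ∑' z, P x z * Q (n + n) z y ≤ ∑' z, P x z * (C' * (n : ℝ) ^ (-q)) :=
              Summable.tsum_le_tsum (fun z => mul_le_mul_of_nonneg_left (heven n z y hn) (hP0 x z))
                (summable_kernel_mul_kpow hP0 hPs hP1' hQ0 hQ _ x y) ((hPs x).mul_right _)
          _ = (∑' z, P x z) * (C' * (n : ℝ) ^ (-q)) := tsum_mul_right
          _ = C' * (n : ℝ) ^ (-q) := by rw [(hP1 x).tsum_eq, one_mul]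
      calc Q (2 * n + 1) x y = ∑' z, P x z * Q (n + n) z y := hrec
        _ ≤ C' * (n : ℝ) ^ (-q) := hbd
        _ ≤ C' * ((3 : ℝ) ^ q * ((2 * n + 1 : ℕ) : ℝ) ^ (-q)) :=
            mul_le_mul_of_nonneg_left (hcmp n hn (by omega)) hC'pos.le
        _ = (C' * (3 : ℝ) ^ q) * ((2 * n + 1 : ℕ) : ℝ) ^ (-q) := by ring
        _ ≤ max 1 (C' * (3 : ℝ) ^ q) * ((2 * n + 1 : ℕ) : ℝ) ^ (-(d : ℝ) / α) := by
            rw [hq, neg_div]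
            exact mul_le_mul_of_nonneg_right (le_max_right _ _) hNq.le

end Kernel

end Literature.Probability.Process
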